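import Summits.FinalStateConjecture.FinalStateConjecture.Theses.NoVacuumStrings
import Literature.Geometry.Lorentzian.TrappedSurface
import HarnessLib

/-!
# Birth skeleton — crux stmt-FinalStateConjecture-12914 `Theses.NoVacuumStrings.LonelyNakedTips` (rank 2)
# line `birth` (skeleton registrar planner-skel-stmt-FinalStateConjecture-12914-0, 2026-08-17; BC3 of run/shared/lean/lens3/_common/BC.md)

The crux (verbatim the route decl): for admissible vacuum data `D`, every MGHD `𝒟` of `D`, every
first naked point `P` of `𝒟` (a TIP, visible from infinity, minimal among TIPs), every `C²` tangent
profile `(𝓩, P₀)` of `𝒟` at `P` whose marked past `P₀` is a MINIMAL TIP of the model `𝓩` and whose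
metric is non-flat (granted its Levi-Civita connection), every Killing field `K` of `𝓩` and every
integral curve `γ` of `K` on `uIcc 0 t`: `γ 0 ∈ P₀ → γ t ∈ P₀` — no continuous isometry of a
singularity model at a first naked point moves its tip (symmetry rank `0`: no string, sheet or loop
of tips).

The cut is the route header's own seam for this item (RANKED CRUXES #2 and TWO-LAYER PLAN:
"null/timelike translations contradict firstness" = glue; "closed transverse slices ⇒ trapped
Killing orbits" + "sub-critical ⇒ globally regular, cannot be tangent at a singular tip" = the rank
gap proper; "closed trapped surfaces of an MGHD of AF data do not meet `J⁻` of the far rays ⇒ `P`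
not visible" = the closure/invisibility lemma), typed WITHOUT the pending definitions
`U1Reduction` / `TransverseEnergy` (items 14026 / 14082 stay informal) by stating the dichotomy
through its OUTCOME — a closed trapped sphere OF THE MODEL through the tip's past — over the
existing vocabulary `LorentzianMetric.IsTrappedSurface (𝓡 2)` (TrappedSurface.lean; sphere
topology `Metric.sphere (0 : E3) 1` as elsewhere in this summit, cf. `Kasner.SliceData.isTrappedSurface`):

* `stub_moverIsSpacelike` (G, the GLUE; size M/L): if a Killing orbit `γ` LEAVES the minimal tip
  past (`γ 0 ∈ P₀`, `γ t ∉ P₀`), the mover is strictly spacelike on the orbit,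
  `0 < g_𝓩(K, K)(γ 0)` (`g(K,K)` is constant along `γ`). A timelike or null mover nests the
  transported tips causally inside one another (a TIP strictly inside `P₀`), against minimality;
  `K(γ 0) = 0` makes `γ` constant. Pure causal-boundary theory + local Killing flows.
* `stub_spacelikeMoverIsTrapped` (R, the RANK GAP proper = card K1 + K3 first half; size XL,
  open-problem): a spacelike mover leaving the tip of a NON-FLAT model AT A FIRST NAKED POINT of
  an MGHD of admissible data forces a closed trapped sphere of the model meeting `P₀`. Intended
  proof = the card's transverse-energy dichotomy for the Geroch–Moncrief `U(1)` reduction along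
  `K`: closed / super-critical transverse slices (and ranks 2–3, Kasner) ⇒ the Killing orbits near
  the tip lie on closed trapped 2-spheres `≈ S²_⊥ × {z}` (conical closure at deficit `2π`,
  Deser–Jackiw–'t Hooft; tree: `KasnerTrappedSphere`); sub-critical ⇒ the reduced 2+1
  Einstein–wave-map(ℍ²) solution is globally regular and disperses (Moncrief's AF `U(1)` problem;
  equivariant case arXiv:1501.00616, arXiv:2204.01157, arXiv:1311.4495), so `𝓩` is flat or has no
  minimal TIP; a closed LOOP of tips is a rotation about an axis missing the tip, same dichotomy.
* `stub_nakedModelUntrapped` (N, NAKED TIPS ARE UNTRAPPED AT THEIR OWN SCALE; size L): a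
  non-flat `C²` model, centred at a minimal TIP, of an MGHD of admissible data at a first naked
  point carries NO closed trapped sphere meeting `P₀`. Intended proof: descend `f` along the
  blow-up sequence (`ψₙ ∘ f` is trapped in `(M, g)` for `n ≫ 1` — `C²_loc` convergence controls
  both null expansions, trappedness is scale-invariant — and meets `P` by centring,
  `BlowupSequence.eventually_mem`); non-flatness makes `ψₙ(range f)` leave every compact set of `M`;
  a far ray seeing `P` enters `I⁺(ψₙ ∘ f)` through `∂J⁺(ψₙ ∘ f)`, generated by focal-free null
  normal segments of `g`-affine length `≤ 2ƛₙ/|θ|` (Raychaudhuri + vacuum NEC), i.e. it must pass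
  at blow-up distance from the tip for every `n`, while the bounded-sojourn far rays of
  `IsVisibleFromInfinity` stay away from it — the replacement, from maximality + firstness +
  centring, of Hawking–Ellis Prop. 9.2.1 (which assumes asymptotic predictability and cannot be
  quoted; refuter crux-attack note 2026-08-15).

Composition `LonelyNakedTips_of : Sig.G → Sig.R → Sig.N → LonelyNakedTips`: suppose `γ t ∉ P₀`;
G makes the mover spacelike, R produces a closed trapped sphere of `𝓩` meeting `P₀`, N says the
model at a first naked point has none — contradiction. Every stub keeps the crux's `𝒟`-side
prefix (admissible `D`, MGHD, `FirstNakedPoint P`, profile, minimal TIP, non-flat): the refuter's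
decoration test (Kruskal `r = 0 ≅ ℝ × S²` of pairwise incomparable minimal TIPs moved by the
spacelike `∂_{t_s}`; reversed non-flat Kasner) shows the `𝓩`-side alone is FALSE, and those very
witnesses are consistent with G (the mover is spacelike), with R (Kruskal / Kasner interiors are
foliated by trapped spheres) and are excluded only by N's visibility hypothesis. The trapped
sphere lives in the MODEL, whose Levi-Civita instance the crux grants (`∀ [𝓩.metric.HasLeviCivita]`),
not in `𝒟`, whose instance the crux hypotheses do not supply (`FirstNakedPoint` binds it inside).
Disproof.lean: none exists for this crux (`ledger crux ls` showed no workfiles at registration), so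
there are no `_false_without_` obligations; negatives index: one unrelated entry
(`not_UniformPhotonSphereChannels`).
-/

set_option linter.dupNamespace false

noncomputable section

open scoped Manifold ContDiff Topology
open Filter Set Function Literature.Geometry.Lorentzian

namespace Summit.FinalStateConjecture.FinalStateConjecture.Cruxes.LonelyNakedTips.Birth

open Summit.FinalStateConjecture.FinalStateConjecture.Theses.NoVacuumStrings (LonelyNakedTips)

/-! ## Legend: the three stub statements as named propositions (verbatim the registered signatures) -/

/-- Statement of `stub_moverIsSpacelike` (G): a Killing orbit leaving the minimal tip past of a
non-flat model at a first naked point has a strictly spacelike mover. -/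
def Sig.stub_moverIsSpacelike : Prop :=
  ∀ (X : Type) [TopologicalSpace X] [ChartedSpace Literature.Geometry.Lorentzian.E3 X] [IsManifold (𝓡 3) ((⊤ : ℕ∞) : WithTop ℕ∞) X] [T2Space X] [SecondCountableTopology X] [ConnectedSpace X], ∀ D ∈ Literature.Geometry.Lorentzian.admissibleVacuumData X, ∀ 𝒟 : Literature.Geometry.Lorentzian.VacuumCauchyDevelopment D, 𝒟.IsMaximal → ∀ P : Set 𝒟.carrier, 𝒟.toCauchyDevelopment.FirstNakedPoint P → ∀ (𝓩 : Literature.Geometry.Lorentzian.Spacetime.{0} 4) (P₀ : Set 𝓩.carrier), Literature.Geometry.Lorentzian.Spacetime.IsTangentProfileAt 𝒟.toSpacetime P 𝓩 P₀ 2 → 𝓩.metric.IsMinimalTIP 𝓩.timeOrientation P₀ → ∀ [𝓩.metric.HasLeviCivita], ¬ 𝓩.metric.leviCivita.IsFlat → ∀ (K : Π x : 𝓩.carrier, TangentSpace (𝓡 4) x) (γ : ℝ → 𝓩.carrier) (t : ℝ), 𝓩.metric.IsKillingField K → IsMIntegralCurveOn γ K (Set.uIcc 0 t) → γ 0 ∈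 P₀ → γ t ∉ P₀ → 0 < 𝓩.metric.val (γ 0) (K (γ 0)) (K (γ 0))

/-- Statement of `stub_spacelikeMoverIsTrapped` (R): a strictly spacelike mover leaving the minimal
tip past of a non-flat model at a first naked point forces a closed trapped sphere of the model
meeting the tip past. -/
def Sig.stub_spacelikeMoverIsTrapped : Prop :=
  ∀ (X : Type) [TopologicalSpace X] [ChartedSpace Literature.Geometry.Lorentzian.E3 X] [IsManifold (𝓡 3) ((⊤ : ℕ∞) : WithTop ℕ∞) X] [T2Space X] [SecondCountableTopology X] [ConnectedSpace X], ∀ D ∈ Literature.Geometry.Lorentzian.admissibleVacuumData X, ∀ 𝒟 : Literature.Geometry.Lorentzian.VacuumCauchyDevelopment D, 𝒟.IsMaximal → ∀ P : Set 𝒟.carrier, 𝒟.toCauchyDevelopment.FirstNakedPoint P → ∀ (𝓩 : Literature.Geometry.Lorentzian.Spacetime.{0} 4) (P₀ : Set 𝓩.carrier), Literature.Geometry.Lorentzian.Spacetime.IsTangentProfileAt 𝒟.toSpacetime P 𝓩 P₀ 2 → 𝓩.metric.IsMinimalTIP 𝓩.timeOrientation P₀ → ∀ [𝓩.metric.HasLeviCivita],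 ¬ 𝓩.metric.leviCivita.IsFlat → ∀ (K : Π x : 𝓩.carrier, TangentSpace (𝓡 4) x) (γ : ℝ → 𝓩.carrier) (t : ℝ), 𝓩.metric.IsKillingField K → IsMIntegralCurveOn γ K (Set.uIcc 0 t) → γ 0 ∈ P₀ → γ t ∉ P₀ → 0 < 𝓩.metric.val (γ 0) (K (γ 0)) (K (γ 0)) → ∃ f : Metric.sphere (0 : Literature.Geometry.Lorentzian.E3) 1 → 𝓩.carrier, 𝓩.metric.IsTrappedSurface (𝓡 2) 𝓩.timeOrientation f ∧ (Set.range f ∩ P₀).Nonempty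

/-- Statement of `stub_nakedModelUntrapped` (N): a non-flat model, centred at a minimal TIP, of an
MGHD of admissible data at a first naked point carries no closed trapped sphere meeting the tip
past. -/
def Sig.stub_nakedModelUntrapped : Prop :=
  ∀ (X : Type) [TopologicalSpace X] [ChartedSpace Literature.Geometry.Lorentzian.E3 X] [IsManifold (𝓡 3) ((⊤ : ℕ∞) : WithTop ℕ∞) X] [T2Space X] [SecondCountableTopology X] [ConnectedSpace X], ∀ D ∈ Literature.Geometry.Lorentzian.admissibleVacuumData X, ∀ 𝒟 : Literature.Geometry.Lorentzian.VacuumCauchyDevelopment D, 𝒟.IsMaximal → ∀ P : Set 𝒟.carrier, 𝒟.toCauchyDevelopment.FirstNakedPoint P → ∀ (𝓩 : Literature.Geometry.Lorentzian.Spacetime.{0} 4) (P₀ : Set 𝓩.carrier), Literature.Geometry.Lorentzian.Spacetime.IsTangentProfileAt 𝒟.toSpacetime P 𝓩 P₀ 2 → 𝓩.metric.IsMinimalTIP 𝓩.timeOrientation P₀ → ∀ [𝓩.metric.HasLeviCivita], ¬ 𝓩.metric.leviCivita.IsFlat → ∀ f : Metric.sphere (0 : Literature.Geometry.Lorentzian.E3)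 1 → 𝓩.carrier, 𝓩.metric.IsTrappedSurface (𝓡 2) 𝓩.timeOrientation f → Disjoint (Set.range f) P₀

/-! ## Registered stubs (`sorry` only here; signatures def-free and self-contained) -/

/-- **G — A TIP-MOVING KILLING ORBIT IS SPACELIKE** (the route's glue sentence for this item:
"null/timelike translations contradict firstness").  For admissible `D`, an MGHD `𝒟`, a first naked
point `P`, a `C²` tangent profile `(𝓩, P₀)` at `P` with `P₀` a minimal TIP of `𝓩` and `𝓩` non-flat,
a Killing field `K` of `𝓩` and an integral curve `γ` of `K` on `uIcc 0 t` with `γ 0 ∈ P₀` but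
`γ t ∉ P₀`: `0 < g_𝓩(K(γ 0), K(γ 0))`.  `g(K, K)` is constant along `γ` (Killing equation), so the
mover has one causal character on the orbit; if `K(γ 0) = 0` the orbit is constant (uniqueness of
integral curves of the `C^∞` field `K`, Mathlib `isMIntegralCurveOn_Ioo_eqOn_of_contMDiff`-type) and
cannot leave; if `K` is timelike or null on the orbit, the local flow `φ_s` of `K` — a local
isometry preserving the time orientation class along the orbit — transports the generating endless
timelike curve of `P₀ = I⁻[σ]` near the tip to generators of TIPs `φ_s(P₀)` which are nested
CAUSALLY (`φ_{-s}(P₀) ⊊ P₀` for the future-directed sign), a TIP strictly inside the minimal TIP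
`P₀` — contradiction (Geroch–Kronheimer–Penrose 1972; Hawking–Ellis 1973 §6.8, p. 219: the causal
relation of `M̂` on ideal points is inclusion).  Why it might fail: `K` need not be complete, the
flow is only local near the orbit and `P₀` is non-compact, so "`φ_s(P₀)` is a TIP" needs a
localisation of the TIP to a neighbourhood of its tip (generator tails) that the typed `IsTIP`
(`I⁻(γ(s))` of an endless curve on an `OrdConnected` set) may not support without strong causality
of `𝓩`; a null mover tangent to `∂P₀` (plane-wave-like profile) transports `P₀` into itself for one
sign of `s` and must be caught by the other.  Sources: HawkingEllis1973CUP §6.8 (Prop. 6.8.1,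
p. 219), ONeill1983 Ch. 9 (Killing fields, Prop. 9.23–9.25), doi:10.1098/rspa.1972.0062,
refuter note stmt-FinalStateConjecture-12914 (2026-08-15: `t` of either sign excludes timelike/null
translations — intended).  Size: M/L. -/
theorem stub_moverIsSpacelike : ∀ (X : Type) [TopologicalSpace X] [ChartedSpace Literature.Geometry.Lorentzian.E3 X] [IsManifold (𝓡 3) ((⊤ : ℕ∞) : WithTop ℕ∞) X] [T2Space X] [SecondCountableTopology X] [ConnectedSpace X], ∀ D ∈ Literature.Geometry.Lorentzian.admissibleVacuumData X, ∀ 𝒟 : Literature.Geometry.Lorentzian.VacuumCauchyDevelopment D, 𝒟.IsMaximal → ∀ P : Set 𝒟.carrier, 𝒟.toCauchyDevelopment.FirstNakedPoint P → ∀ (𝓩 : Literature.Geometry.Lorentzian.Spacetime.{0} 4) (P₀ : Set 𝓩.carrier), Literature.Geometry.Lorentzian.Spacetime.IsTangentProfileAt 𝒟.toSpacetime P 𝓩 P₀ 2 → 𝓩.metric.IsMinimalTIP 𝓩.timeOrientation P₀ → ∀ [𝓩.metric.HasLeviCivita], ¬ 𝓩.metric.leviCivita.IsFlat → ∀ (K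 : Π x : 𝓩.carrier, TangentSpace (𝓡 4) x) (γ : ℝ → 𝓩.carrier) (t : ℝ), 𝓩.metric.IsKillingField K → IsMIntegralCurveOn γ K (Set.uIcc 0 t) → γ 0 ∈ P₀ → γ t ∉ P₀ → 0 < 𝓩.metric.val (γ 0) (K (γ 0)) (K (γ 0)) := by
  sorry

/-- **R — A SPACELIKE TIP-MOVER OF A NAKED MODEL IS CLOTHED BY TRAPPED SPHERES** (the RANK GAP
proper: card K3 "closed strings are trapped" + K1 "sub-critical strings disperse", in outcome form).
For `(D, 𝒟, P, 𝓩, P₀)` as in the crux (model at a first naked point, minimal TIP, non-flat), a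
Killing field `K`, an integral curve `γ` on `uIcc 0 t` with `γ 0 ∈ P₀`, `γ t ∉ P₀` and
`0 < g_𝓩(K, K)(γ 0)`: there is a closed trapped sphere `f : S² → 𝓩` of the model
(`IsTrappedSurface (𝓡 2)`: compact, smoothly embedded, spacelike, both null expansions negative for
every null normal pair) whose image meets `P₀`.  Intended proof (the card's dichotomy, by the
TRANSLATION part of the mover): (i) `K` without zeros near `closure P₀` ∩ (tip region) — a string of
tips: Geroch–Moncrief reduction along `K` gives 2+1 gravity coupled to a wave map into `ℍ²`
(Geroch 1971; Moncrief doi:10.1016/s0003-4916(86)80009-4); if the transverse energy per unit Killing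
length reaches the `2π` deficit the maximal transverse slices close up (Deser–Jackiw–'t Hooft
doi:10.1016/0003-4916(84)90085-x, Gauss–Bonnet with `R⁽²⁾ = 16πρ + |k|² ≥ 0`) and the orbits through
`P₀` near the tip lie on closed 2-spheres `S²_⊥ × {z}` both of whose null expansions equal the
contraction rate of the closed 2+1 slice — trapped (tree pattern: `Kasner.SliceData.isTrappedSurface`);
if sub-critical, the reduced solution is a finite-energy 2+1 Einstein–wave-map(ℍ²) development which
is globally regular and disperses (equivariant: arXiv:1501.00616, arXiv:1311.4495, scattering
arXiv:2204.01157; general AF `U(1)`: Moncrief's open problem), so `𝓩` is future complete along the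
string and carries no minimal TIP at all (or is flat) — this branch is EMPTY under the hypotheses;
ranks 2–3 (Einstein–Rosen / Kasner, infinite transverse energy) fall in the closed branch
(arXiv:gr-qc/9404005: AF cylindrical vacuum forms neither; Kasner: trapped spheres); (ii) `K`
vanishing on an axis missing the tip (a closed LOOP of tips, rotation → translation at the orbit):
the same dichotomy for the reduction off the axis.  Why it might fail: leans on Moncrief's
LARGE-data asymptotically flat `U(1)` problem (open; only equivariant / small data known) to empty
the sub-critical branch, and on an unproved hoop CAP (closed transverse slices ⇒ trapped spheres
THROUGH `P₀`, not merely somewhere: the transverse sphere may be anti-trapped or Kasner-like with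
non-compact orbits near the tip); one admissible datum whose MGHD has a visible simultaneous line or
ring blow-up with an untrapped neighbourhood of the tip refutes it (printed lead: prolate vacuum
'strings' of Abrahams–Heiderich–Shapiro–Teukolsky PRD 46 (1992) 2452, data only).  Sources:
doi:10.1016/s0003-4916(86)80009-4, doi:10.1016/0003-4916(84)90085-x, doi:10.1103/physrevlett.85.3758,
arXiv:1501.00616, arXiv:2204.01157, arXiv:1311.4495, arXiv:gr-qc/9404005, arXiv:1106.5184,
doi:10.1017/cbo9780511628863 (pp. 319–326).  Size: XL (open-problem). -/
theorem stub_spacelikeMoverIsTrapped : ∀ (X : Type) [TopologicalSpace X] [ChartedSpace Literature.Geometry.Lorentzian.E3 X] [IsManifold (𝓡 3) ((⊤ : ℕ∞) : WithTop ℕ∞) X] [T2Space X] [SecondCountableTopology X] [ConnectedSpace X], ∀ D ∈ Literature.Geometry.Lorentzian.admissibleVacuumData X, ∀ 𝒟 : Literature.Geometry.Lorentzian.VacuumCauchyDevelopment D, 𝒟.IsMaximal → ∀ P : Set 𝒟.carrier, 𝒟.toCauchyDevelopment.FirstNakedPoint P → ∀ (𝓩 : Literature.Geometry.Lorentzian.Spacetime.{0}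 4) (P₀ : Set 𝓩.carrier), Literature.Geometry.Lorentzian.Spacetime.IsTangentProfileAt 𝒟.toSpacetime P 𝓩 P₀ 2 → 𝓩.metric.IsMinimalTIP 𝓩.timeOrientation P₀ → ∀ [𝓩.metric.HasLeviCivita], ¬ 𝓩.metric.leviCivita.IsFlat → ∀ (K : Π x : 𝓩.carrier, TangentSpace (𝓡 4) x) (γ : ℝ → 𝓩.carrier) (t : ℝ), 𝓩.metric.IsKillingField K → IsMIntegralCurveOn γ K (Set.uIcc 0 t) → γ 0 ∈ P₀ → γ t ∉ P₀ → 0 < 𝓩.metric.val (γ 0) (K (γ 0)) (K (γ 0)) → ∃ f : Metric.sphere (0 : Literature.Geometry.Lorentzian.E3) 1 → 𝓩.carrier, 𝓩.metric.IsTrappedSurface (𝓡 2) 𝓩.timeOrientation f ∧ (Set.range f ∩ P₀).Nonempty := by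
  sorry

/-- **N — NAKED TIPS ARE UNTRAPPED AT THEIR OWN SCALE** (the route's closure sentence "closed
trapped surfaces of an MGHD of AF data do not meet `J⁻` of the far rays", transplanted to the model).
For admissible `D`, an MGHD `𝒟`, a first naked point `P` of `𝒟`, and a `C²` tangent profile
`(𝓩, P₀)` of `𝒟` at `P` with `P₀` a minimal TIP and `𝓩` non-flat: NO closed trapped sphere
`f : S² → 𝓩` of the model meets `P₀` (`Disjoint (range f) P₀`).  Intended proof: (1) DESCENT —
along a blow-up sequence `(ƛₙ, ψₙ)` (`BlowupSequence`: eventual time-oriented smooth open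
embeddings near the compact `range f`, `ƛₙ⁻² ψₙ^* g → g_𝓩` in `C²` on compact coordinate patches)
the spheres `ψₙ ∘ f` are closed trapped surfaces of `(M, g)` for `n ≫ 1` (null expansions are
continuous in the metric in `C¹`-of-Christoffel = `C²`-of-metric topology; trappedness is invariant
under the constant rescaling `ƛₙ²` and under `(L, L̲) ↦ (aL, a⁻¹L̲)`, swap), and they meet `P`
eventually (centring, `BlowupSequence.eventually_mem`); (2) CONCENTRATION — since `g_𝓩` is not
flat, `ψₙ(C)` leaves every compact subset of `M` for compact `C` (a subsequence staying in a compact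
set would blow `g` up at a regular point, whose `C²` blow-up limit is flat); (3) BLIND SPOT — a far
ray `δ` of `IsVisibleFromInfinity` with `P ⊆ I⁻(δ⁺)` enters `I⁺(ψₙ ∘ f)` and crosses
`∂J⁺(range (ψₙ ∘ f))`, which in the globally hyperbolic `𝒟` is generated by focal-point-free null
normal geodesic segments from the sphere of `g`-affine length `< 2ƛₙ/|θ|` (Raychaudhuri, vacuum NEC;
Hawking–Ellis §4.4, Prop. 4.5.14, O'Neill 10.72), so `δ` passes at blow-up distance `O(ƛₙ)` from the
tip for every `n`; its parameters there tend to `sup dom` by (2), i.e. the far ray ENDS AT the tip,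
whereas the rays of `IsVisibleFromInfinity` start outside every compact `B₁` with sojourn in
`J⁺(ι B₀)` bounded independently of `B₁` and (maximality + Cauchy hypersurface) `J⁻` of a region at
bounded blow-up distance from the tip meets `ι X` in a set independent of `B₁` — the test-table
dichotomy of `IdealPoints` ("far rays ENTER only the ideal points at `v = ∞`").  This replaces
Hawking–Ellis Prop. 9.2.1 (trapped surfaces lie in `M ∖ J⁻(𝓘⁺)`), which assumes future asymptotic
predictability — censorship — and cannot be quoted (refuter crux-attack note, 2026-08-15).  Why it
might fail: the `g`-affine bound `2ƛₙ/|θ|` is in the frame of the tip region at scale `ƛₙ`; an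
unbounded blueshift between that frame and the asymptotic frame along the outgoing cone of the tip
(extremal-like or null singular structure) would let the short generators of `∂J⁺` reach far out,
where the far rays cross; the typed visibility bounds sojourn, not `J⁻(tip) ∩ ι X`, so step (3)
needs `closure P ∩ ι X` compact, which a first naked point need not grant as typed; and the
`C²`-stability of `IsTrappedSurface` asks `C¹` null normal pairs of `ψₙ ∘ f` for `g`, to be built
from those of `f`.  Sources: Penrose1965, HawkingEllis1973CUP (§4.4–4.5, §6.8, Prop. 9.2.1 p. 311),
ONeill1983 (Ch. 10, 14), MorganTian2007 Def. 5.3/5.32, RodnianskiShlapentokhRothman2023 (p. 3,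
Def. 1.1), Christodoulou1999 p. A27, tree `Kasner.SliceData.isTrappedSurface`,
`IsVisibleFromInfinity.not_hasCompleteFutureNullInfinity`.  Size: L. -/
theorem stub_nakedModelUntrapped : ∀ (X : Type) [TopologicalSpace X] [ChartedSpace Literature.Geometry.Lorentzian.E3 X] [IsManifold (𝓡 3) ((⊤ : ℕ∞) : WithTop ℕ∞) X] [T2Space X] [SecondCountableTopology X] [ConnectedSpace X], ∀ D ∈ Literature.Geometry.Lorentzian.admissibleVacuumData X, ∀ 𝒟 : Literature.Geometry.Lorentzian.VacuumCauchyDevelopment D, 𝒟.IsMaximal → ∀ P : Set 𝒟.carrier, 𝒟.toCauchyDevelopment.FirstNakedPoint P → ∀ (𝓩 : Literature.Geometry.Lorentzian.Spacetime.{0} 4) (P₀ : Set 𝓩.carrier), Literature.Geometry.Lorentzian.Spacetime.IsTangentProfileAt 𝒟.toSpacetime P 𝓩 P₀ 2 → 𝓩.metric.IsMinimalTIP 𝓩.timeOrientation P₀ → ∀ [𝓩.metric.HasLeviCivita], ¬ 𝓩.metric.leviCivita.IsFlat → ∀ f : Metric.sphere (0 : Literature.Geometry.Lorentzian.E3) 1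 → 𝓩.carrier, 𝓩.metric.IsTrappedSurface (𝓡 2) 𝓩.timeOrientation f → Disjoint (Set.range f) P₀ := by
  sorry

/-! ## Composition: the crux BY NAME from the three stubs (real proof, no `sorry`) -/

/-- **LonelyNakedTips from G, R and N**: fix the crux's data and suppose the Killing orbit leaves
the tip past, `γ t ∉ P₀`; by G the mover is strictly spacelike on the orbit; by R the model then
carries a closed trapped sphere meeting `P₀`; by N a non-flat model centred at a minimal TIP of an
MGHD of admissible data at a first naked point carries none — contradiction.  Pure logic over the
three stubs; the instance binder `∀ [𝓩.metric.HasLeviCivita]` is threaded. -/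
theorem LonelyNakedTips_of :
    Sig.stub_moverIsSpacelike → Sig.stub_spacelikeMoverIsTrapped → Sig.stub_nakedModelUntrapped →
      LonelyNakedTips := by
  intro hG hR hN X _ _ _ _ _ _ D hD 𝒟 hmax P hP 𝓩 P₀ hT hmin inst hnf K γ t hK hγ h0
  by_contra ht
  -- Step 1 (G): a Killing orbit leaving the minimal tip past has a strictly spacelike mover
  have hsp : 0 < 𝓩.metric.val (γ 0) (K (γ 0)) (K (γ 0)) :=
    hG X D hD 𝒟 hmax P hP 𝓩 P₀ hT hmin hnf K γ t hK hγ h0 ht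
  -- Step 2 (R): a spacelike tip-mover of a naked model forces a closed trapped sphere through `P₀`
  obtain ⟨f, hf, hne⟩ := hR X D hD 𝒟 hmax P hP 𝓩 P₀ hT hmin hnf K γ t hK hγ h0 ht hsp
  -- Step 3 (N): but a model at a first naked point carries no closed trapped sphere meeting `P₀`
  exact Set.not_disjoint_iff_nonempty_inter.mpr hne (hN X D hD 𝒟 hmax P hP 𝓩 P₀ hT hmin hnf f hf)

/-- The crux by name, closed modulo the three registered stubs (checks that the `Sig.*` legend is
the stub signatures verbatim). -/
theorem lonelyNakedTips_of_stubs : LonelyNakedTips :=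
  LonelyNakedTips_of stub_moverIsSpacelike stub_spacelikeMoverIsTrapped stub_nakedModelUntrapped

/-! ## Sanity (no `sorry`): G and R are genuine WEAKENINGS of the crux (vacuously: the crux says a
Killing orbit never leaves the tip past); N is independent of Killing fields (the closure lemma). -/

/-- The crux implies G. -/
theorem stub_moverIsSpacelike_of_crux (h : LonelyNakedTips) : Sig.stub_moverIsSpacelike := by
  intro X _ _ _ _ _ _ D hD 𝒟 hmax P hP 𝓩 P₀ hT hmin inst hnf K γ t hK hγ h0 ht
  exact absurd (h X D hD 𝒟 hmax P hP 𝓩 P₀ hT hmin hnf K γ t hK hγ h0) ht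

/-- The crux implies R. -/
theorem stub_spacelikeMoverIsTrapped_of_crux (h : LonelyNakedTips) :
    Sig.stub_spacelikeMoverIsTrapped := by
  intro X _ _ _ _ _ _ D hD 𝒟 hmax P hP 𝓩 P₀ hT hmin inst hnf K γ t hK hγ h0 ht _
  exact absurd (h X D hD 𝒟 hmax P hP 𝓩 P₀ hT hmin hnf K γ t hK hγ h0) ht

end Summit.FinalStateConjecture.FinalStateConjecture.Cruxes.LonelyNakedTips.Birth

end
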